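import Summits.KontsevichZagierPeriods.KontsevichZagierPeriods.Theorems.TerasomaMultiplicationBetaCancellationStubTameFormAux8

/-!
# `BetaCancellation` (stmt-KontsevichZagierPeriods-13633), line `divisor-slicing-transshipment` — stub `stub_tameForm`, auxiliary file 9: rule (2) has vanishing shadow

**Rule (2) (change of variables) has vanishing `K₀`-shadow.** For a generator `[r] − [r']` of
`KZ.changeOfVariablesRel` along `Φ` (`f = (f' ∘ Φ) · |det Φ'|` on `σ = r.domain`, `r'.domain = Φ σ`)
the substitution `Φ` restricted to `{f > 0}` is ONE piece of a finite piecewise measure isomorphism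
`({f>0}, f) ≅ ({f'>0}, f')`: the part of `{f' > 0}` it misses lies in the image of the set where the
Jacobian determinant vanishes, which is null by the area inequality
(`MeasureTheory.addHaar_image_le_lintegral_abs_det_fderiv`). Likewise `({f<0}, −f) ≅ ({f'<0}, −f')`,
which is inverted by `MIso.symm`; the juxtaposition of the two is the shadow relation
`r⁺ ⊔ r'⁻ ≅ r'⁺ ⊔ r⁻`.

References: M. Kontsevich, D. Zagier, *Periods* (2001), §1.2 rule (2); crux NOTES c6 (F13).
-/

noncomputable section

-- `Summit.KontsevichZagierPeriods.KontsevichZagierPeriods.…` is the tree's mandated layout (single-conjunct summit).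
set_option linter.dupNamespace false

namespace Summit.KontsevichZagierPeriods.KontsevichZagierPeriods.BetaCancellationDivisorSlicing

open MeasureTheory Set Function
open Literature.NumberTheory.Transcendental
open Literature.NumberTheory.Transcendental.KZ
open Literature.ModelTheory.ExponentialFields (IsSemialgebraic isSemialgebraic_univ)

variable {N n : ℕ}

/-! ### One-piece isomorphisms and images of critical sets -/

/-- **A one-piece `MIso`** between two single measured sets. [folklore] -/
theorem MIso.single {S T : Set (Fin N → ℝ)} {ρ θ : (Fin N → ℝ) → ℝ} (P : Set (Fin N → ℝ))
    (Ψ : (Fin N → ℝ) → (Fin N → ℝ)) (Ψ' : (Fin N → ℝ) → ((Fin N → ℝ) →L[ℝ] (Fin N → ℝ)))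
    (hP : IsSemialgebraic ℚ P) (hPS : P ⊆ S) (hΨ : IsSemialgebraicMapOn ℚ P Ψ) (hinj : InjOn Ψ P)
    (hderiv : ∀ z ∈ P, HasFDerivWithinAt Ψ (Ψ' z) P z) (himg : Ψ '' P ⊆ T)
    (hdens : ∀ z ∈ P, ρ z = θ (Ψ z) * |(Ψ' z).det|) (hcovS : volume (S \ P) = 0)
    (hcovT : volume (T \ Ψ '' P) = 0) :
    Nonempty (MIso N (fun _ : Unit => S) (fun _ => ρ) (fun _ : Unit => T) (fun _ => θ)) :=
  MIso.of_fintype (P₀ := Unit) (fun _ => ()) (fun _ => ()) (fun _ => P) (fun _ => Ψ) (fun _ => Ψ')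
    (fun _ => ⟨hP, hPS, hΨ, hinj, hderiv, himg, hdens⟩) (fun _ _ h => (h rfl).elim)
    (fun _ _ h => (h rfl).elim) (fun _ => by simpa [iUnion_const] using hcovS)
    (fun _ => by simpa [iUnion_const] using hcovT)

/-- **The image of the critical set is null**: if `Φ` has a derivative of zero determinant within
a measurable `E` at every point of `E`, then `Φ E` is null (area inequality). [folklore] -/
theorem volume_image_null_of_det_eq_zero {E : Set (Fin N → ℝ)} {Φ : (Fin N → ℝ) → (Fin N → ℝ)}
    {Φ' : (Fin N → ℝ) → ((Fin N → ℝ) →L[ℝ] (Fin N → ℝ))} (hE : MeasurableSet E)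
    (hΦ' : ∀ x ∈ E, HasFDerivWithinAt Φ (Φ' x) E x) (hdet : ∀ x ∈ E, (Φ' x).det = 0) :
    volume (Φ '' E) = 0 := by
  have hle := addHaar_image_le_lintegral_abs_det_fderiv volume hE hΦ'
  rw [setLIntegral_eq_zero hE fun x hx => by simp [hdet x hx]] at hle
  exact nonpos_iff_eq_zero.mp hle

/-! ### Rule (2) -/

/-- **The positive parts under a change of variables.** For `f = (f' ∘ Φ) · |det Φ'|` on `σ`
(rule (2) data) the restriction of `Φ` to `{f > 0}` is a one-piece `MIso`
`({f > 0}, f) ≅ ({f' > 0}, f')`. [cite: KontsevichZagier2001, §1.2 rule (2)] -/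
theorem MIso.cov_pos (r r' : IntegralRep n) (Φ : (Fin n → ℝ) → (Fin n → ℝ))
    (Φ' : (Fin n → ℝ) → ((Fin n → ℝ) →L[ℝ] (Fin n → ℝ))) (hΦ : IsSemialgebraicMapOn ℚ r.domain Φ)
    (hderiv : ∀ x ∈ r.domain, HasFDerivWithinAt Φ (Φ' x) r.domain x) (hinj : InjOn Φ r.domain)
    (hdom : r'.domain = Φ '' r.domain)
    (hint : ∀ x ∈ r.domain, r.integrand x = r'.integrand (Φ x) * |(Φ' x).det|) :
    Nonempty (MIso n (fun _ : Unit => posSet r) (fun _ => r.integrand) (fun _ : Unit => posSet r')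
      (fun _ => r'.integrand)) := by
  have hpos : ∀ x ∈ posSet r, (Φ' x).det ≠ 0 ∧ 0 < r'.integrand (Φ x) := fun x hx =>
    det_ne_zero_of_density (hint x hx.1) hx.2
  refine MIso.single (posSet r) Φ Φ' (isSemialgebraic_posSet r) subset_rfl
    (hΦ.mono (posSet_subset r) (isSemialgebraic_posSet r)) (hinj.mono (posSet_subset r))
    (fun x hx => (hderiv x hx.1).mono (posSet_subset r)) ?_ (fun x hx => hint x hx.1)
    (by simp) ?_
  · rintro _ ⟨x, hx, rfl⟩
    exact ⟨hdom ▸ mem_image_of_mem Φ hx.1, (hpos x hx).2⟩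
  · -- the missed part of `{f' > 0}` is the image of `E = {x ∈ σ | Φ x ∈ {f' > 0}} ∖ {f > 0}`,
    -- on which `det Φ' = 0`
    set E := {x | x ∈ r.domain ∧ Φ x ∈ posSet r'} \ posSet r with hE
    have hEs : IsSemialgebraic ℚ E :=
      (isSemialgebraic_sep_preimage hΦ (isSemialgebraic_posSet r')).diff (isSemialgebraic_posSet r)
    have hEσ : E ⊆ r.domain := fun x hx => hx.1.1
    have hdet : ∀ x ∈ E, (Φ' x).det = 0 := by
      intro x hx
      by_contra h
      have h1 : 0 < |(Φ' x).det| := abs_pos.mpr h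
      have h2 : 0 < r.integrand x := by
        rw [hint x hx.1.1]
        exact mul_pos hx.1.2.2 h1
      exact hx.2 ⟨hx.1.1, h2⟩
    have hsub : posSet r' \ Φ '' posSet r ⊆ Φ '' E := by
      rintro y ⟨hy, hy'⟩
      have hy1 := hy.1
      rw [hdom] at hy1
      obtain ⟨x, hx, rfl⟩ := hy1
      exact ⟨x, ⟨⟨hx, hy⟩, fun hxp => hy' ⟨x, hxp, rfl⟩⟩, rfl⟩
    exact measure_mono_null hsub (volume_image_null_of_det_eq_zero
      (Literature.ModelTheory.ExponentialFields.IsSemialgebraic.measurableSet_holds hEs)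
      (fun x hx => (hderiv x (hEσ hx)).mono hEσ) hdet)

/-- **The negative parts under a change of variables**: `({f < 0}, −f) ≅ ({f' < 0}, −f')` by the
same piece. [cite: KontsevichZagier2001, §1.2 rule (2)] -/
theorem MIso.cov_neg (r r' : IntegralRep n) (Φ : (Fin n → ℝ) → (Fin n → ℝ))
    (Φ' : (Fin n → ℝ) → ((Fin n → ℝ) →L[ℝ] (Fin n → ℝ))) (hΦ : IsSemialgebraicMapOn ℚ r.domain Φ)
    (hderiv : ∀ x ∈ r.domain, HasFDerivWithinAt Φ (Φ' x) r.domain x) (hinj : InjOn Φ r.domain)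
    (hdom : r'.domain = Φ '' r.domain)
    (hint : ∀ x ∈ r.domain, r.integrand x = r'.integrand (Φ x) * |(Φ' x).det|) :
    Nonempty (MIso n (fun _ : Unit => negSet r) (fun _ => -r.integrand) (fun _ : Unit => negSet r')
      (fun _ => -r'.integrand)) := by
  have hint' : ∀ x ∈ r.neg.domain, r.neg.integrand x = r'.neg.integrand (Φ x) * |(Φ' x).det| := by
    intro x hx
    simp only [IntegralRep.integrand_neg, Pi.neg_apply, hint x hx, neg_mul]
  obtain ⟨m⟩ := MIso.cov_pos r.neg r'.neg Φ Φ' hΦ hderiv hinj (by simpa using hdom) hint'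
  exact m.copy (by simp) (by simp) (by simp) (by simp)

namespace Shadow

/-- **Rule (2), change of variables, has vanishing shadow**: `r⁺ ≅ r'⁺` by `Φ`, `r'⁻ ≅ r⁻` by the
inverse of `Φ` (`MIso.symm`), juxtaposed. [cite: KontsevichZagier2001, §1.2 rule (2)] -/
theorem of_mem_changeOfVariablesRel {c : FormalRep} (hc : c ∈ changeOfVariablesRel) :
    Nonempty (Shadow c) := by
  obtain ⟨n, r, r', Φ, Φ', hΦ, hderiv, hinj, hdom, hint, rfl⟩ := hc
  obtain ⟨mpos⟩ := MIso.cov_pos r r' Φ Φ' hΦ hderiv hinj hdom hint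
  obtain ⟨mneg⟩ := MIso.cov_neg r r' Φ Φ' hΦ hderiv hinj hdom hint
  obtain ⟨mneg'⟩ := mneg.symm (fun _ x hx => by simpa using hx.2)
  obtain ⟨m⟩ := mpos.sum mneg'
  obtain ⟨m'⟩ := m.reindex (Equiv.sumCongr (Equiv.equivPUnit (Fin 1)) (Equiv.equivPUnit (Fin 1)))
    (Equiv.sumCongr (Equiv.equivPUnit (Fin 1)) (Equiv.equivPUnit (Fin 1)))
  refine ⟨⟨1, 1, fun _ => ⟨n, r⟩, fun _ => ⟨n, r'⟩, by simp, n, fun _ => le_rfl, fun _ => le_rfl,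
    Classical.choice (m'.copy ?_ ?_ ?_ ?_)⟩⟩
  · funext x; rcases x with i | j <;> simp
  · funext x; rcases x with i | j <;> simp
  · funext x; rcases x with i | j <;> simp
  · funext x; rcases x with i | j <;> simp

end Shadow

/-! ### Headline -/

/-- Registered helper goal of the stub `stub_tameForm`: rule (2) (change of variables) has vanishing
`K₀`-shadow. [cite: KontsevichZagier2001, §1.2 rule (2)] -/
theorem tameForm_aux_shadowCov : ∀ c ∈ changeOfVariablesRel, Nonempty (Shadow c) :=
  fun _ hc => Shadow.of_mem_changeOfVariablesRel hc

end Summit.KontsevichZagierPeriods.KontsevichZagierPeriods.BetaCancellationDivisorSlicing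

end
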